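import Summits.AtomisticToContinuum.BoseEinsteinCondensation.Theses.BECModePrice
import Summits.AtomisticToContinuum.BoseEinsteinCondensation.Theorems.LatticeToPeriodicBridge.Negative.UniformThreshold
import Literature.MathematicalPhysics.QuantumManyBody.PeriodicBoseGasFracEnergy
import Literature.MathematicalPhysics.QuantumManyBody.PeriodicKineticBudget
import Literature.MathematicalPhysics.QuantumManyBody.HardCoreScatteringLength
import Literature.MathematicalPhysics.QuantumManyBody.LiebYngvasonTheorem
import Literature.Barriers.AtomisticToContinuum.KineticGapLengthScalesThermodynamicWindow
import HarnessLib

/-!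
# Disproof of `ModePriceHardCore` — findings (cdisprove seat, crux stmt-AtomisticToContinuum-18513, cycle 1)

Crux (route `BECModePrice`, rank 3): single-mode softening (SMS) for the NON-integrable admissible
potentials (`∫ v(|x|)dx = ⊤`: hard cores, strongly singular cores):
`∀ v admissible, ∫v = ⊤ → ∃ C ρ₀ > 0, ∀ ρ ∈ (0,ρ₀), ∀ᶠ N, ∀ p ≠ 0, ∀ Ψ periodic trial state on the torus of side
L_N = (N/ρ)^{1/3}:  E₀^per(v; N, L_N) + ½|2πp/L_N|² n_p(Ψ) ≤ ⟨Ψ, H_v Ψ⟩ + Cρ`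
("making one mode half-price lowers the ground-state energy by at most `Cρ`", `ħ = 2m = 1`).

VERDICT (cycle 1): NO KILL. The statement resists every cheap attack for one structural reason,
proved below as `energy_lt_two_mul_of_not_body`: by Parseval (`∑_p |k_p|² n_p(Ψ) = T(Ψ) ≤ E(Ψ)`) a
state violating the SMS body at ANY slack must have `E(Ψ) < 2·E₀^per`; hence a certified
counterexample needs a LOWER bound on `E₀^per` within a factor 2 of the energy of an explicit trial
state and, to beat the slack `Cρ`, two-sided control of `E₀^per(N, L_N)` to relative precision
`O(1/N)` in the thermodynamic limit — far beyond Lee–Huang–Yang precision (`Nρa(ρa³)^{1/2}`), not in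
print, not in the tree. Every probe of a hypothesis lands in a regime where the body is settled the
other way: `E₀ = ⊤` (crowded hard spheres, `v ≡ ⊤`) or `E₀ = 0` (`N ≤ 1`), see §A.

## Findings (all `sorry`-free unless marked NEAR-MISS)

§0 `modePriceHardCore_iff` — the crux body re-read through `planeWaveMode` / `fracDispersion`
   (`Iff.rfl`); `hardCore_hypotheses` — the hypotheses are satisfiable (`hardCorePotential 1`).
§A LOAD-BEARING ANALYSIS.
 * `body_zero_mode`, `withoutPNeZero_iff` — the hypothesis `p ≠ 0` is NOT load-bearing: at `p = 0`
   the subtracted dispersion vanishes and the body is `E₀ ≤ E(Ψ) + Cρ`. (The crux with `p ≠ 0`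
   deleted is EQUIVALENT to the crux.)
 * `body_of_energy_eq_top`, `body_of_groundStateEnergy_eq_top` — `⊤`-absorption: states meeting the
   core and boxes with `E₀^per = ⊤` satisfy the body for free.
 * `half_dispersion_mul_occupation_le`, `body_of_two_mul_le`, `energy_lt_two_mul_of_not_body` —
   Parseval half: `½|k|²n_p(Ψ) ≤ ½E(Ψ)`; every state with `E(Ψ) ≥ 2E₀` satisfies the body with ZERO
   slack; violators are near-minimisers (`E < 2E₀`). This also settles `p`-uniformity for far states.
 * `body_zero_particles`, `body_one_particle` — `N = 0, 1`: the body holds with zero slack for every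
   `v`, `L > 0`, `p` (`E₀^per(1) = 0` + Parseval), so "eventually in `N`" is not probed by small `N`.
 * `periodicEnergy_top_potential`, `conclusion_holds_at_top_potential` — dropping FINITE RANGE cannot
   be refuted by the infinite-range hard core `v ≡ ⊤`: there `E = ⊤` for every state with `N ≥ 2` and
   the conclusion holds (junk-true). A genuine infinite-range test (Coulomb/dipolar tails) needs the
   same two-sided energy control as the crux itself.
 * `conclusion_body_hardCore_highDensity` — dropping the density cap `ρ < ρ₀` cannot be refuted at
   HIGH density either: for `ρ > 8/a³` the hard-sphere torus energy is `⊤` eventually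
   (tree: `eventually_periodicGroundStateEnergy_hardCorePotential_eq_top`) and the body is junk-true;
   the dense-fluid / crystal window `ρa³ ∈ (c, 8)` is as open as the crux.
 * `0 < ρ`: for `ρ ≤ 0`, `ofReal (Cρ) = 0` and (`ρ < 0`) `sideLength ρ N = ½|N/ρ|^{1/3} > 0` by the
   `Real.rpow` convention, so the `ρ < 0` instances assert ZERO-slack SMS — the near-miss of §B2; the
   guard `0 < ρ` is therefore load-bearing only through junk arithmetic (not formalised).
§B NATURAL STRENGTHENINGS REFUTED.
 * `not_allModePrice` (PROVED, uses the tree's Lieb–Yngvason lower bound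
   `LSSY2005_lowerBound_periodic_holds`): the MODE-SUMMED inequality
   `E₀ + ½∑_p|k_p|²n_p(Ψ) ≤ E(Ψ) + Cρ` (= `E₀ + ½T(Ψ) ≤ E(Ψ) + Cρ`) is FALSE for the hard core:
   finite-energy hard-core states have `E = T` (`periodicEnergy_hardCore_eq_kinetic`), so at a
   `1`-near-minimiser it would force `E₀^per ≤ 1 + 2Cρ`, against `E₀^per ≥ 2πρN` (LY). Moral: the
   single-mode restriction is load-bearing; no proof may sum SMS over modes (or over any family of
   modes carrying a fixed fraction of the kinetic energy).
 * NEAR-MISS `not_zeroSlackModePrice` (sorry): the slack `Cρ` cannot be dropped (price > 0). Needs: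
   a max-form ground state `η` of the hard-core torus gas has `n_p(η) > 0` for some `p ≠ 0` (else every
   slice `x ↦ η(x, Y)` is constant, impossible for a normalised function vanishing on the hard set) +
   the landed `C¹` approximation `stub_maxFormApproximationFiniteRange` + `L²`-continuity of `n_p`.
   Recorded, not closed: it is "depletion is non-zero", informative but not a threat to the crux.
§C LINE `IdeatorSketchK1` (tower shadow). Joint sufficiency is kernel-certified
   (`ModePriceHardCore_of` in `Lines/IdeatorSketchK1.lean`, 0 own sorries). W1
   `stub_uniformTower_of_scaleFree` is landed (Theorems/BECModePriceModePriceHardCoreStubUniformTowerOfScaleFree).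
   The lead's `stub_scaleFreeModePriceIntegrable` implies the rank-2 sibling crux `ModePriceIntegrable`
   outright (`modePriceIntegrable_of_scaleFree` below: take `R₀` = a positive range of `v`), so it is
   open-problem calibre by design; its extra strength (constants `C, ρ₀, N₀` uniform over all integrable
   `v` of range `≤ R₀`) survives the thought experiments recorded in its docstring (weak-coupling boxes
   `L ≪ ξ`: price `≈ μ²L²/24π² ≪ μ`; truncation towers: `E₀(min(v,n)) ↑ E₀(v)` at fixed volume;
   `a ≤ R₀` caps the Bogoliubov value `0.049·8πρa ≤ 1.24ρR₀`). W2 `stub_uniformTower_of_modePrice`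
   (necessity) — no misstatement found: boxes with `E₀(v) = ⊤` are excluded by its own `ρ₀`
   (Ruelle finiteness), `n₀(N,p)` after `p` matches the compactness argument.
§D NUMERICS (kit job j026683, `compute/sms_price_ed.py`, evidence `compute-j026683.json` on the item;
   18 of 20 cases delivered, job stopped at 12 GB on the `4³, N+1 = 5` chemical-potential run; `28:7` re-queued
   as j026899). Exact diagonalisation of the HALF-softening price `B(k; L) = E₀ − inf spec(H − ½ε_k n̂_k)`,
   hard-core lattice bosons (`t = 1`, `ε_k = Σ(2 − 2cos kᵢ)`), `μ := E₀(N+1) − E₀(N)`, `x := ε_k/μ`,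
   Bogoliubov `b(x) = √(x²+2x) − √(9x²/16+3x/2) − x/4` (sup 0.049):
   rings, filling 1/4 — `L = 8, 12, 16, 20, 24`: `sup_k B/μ = 0.071, 0.079, 0.088, 0.093, 0.094`
     (increments `.009, .008, .006, .001`: SATURATING; absolute `sup_k B = 0.0613, 0.0613, 0.0635, 0.0648,
     0.0640` flat), attained at `x ≈ 0.7–1.3`; infrared `B(k_min)/μ = 0.071, 0.063, 0.052, 0.043, 0.036`
     DECREASING with `L` along Bogoliubov's `0.19√x` law (`b(x_min) = 0.049, 0.049, 0.046, 0.042, 0.039`);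
   rings, filling 1/8 — `L = 16, 24, 32, 40`: `sup_k B/μ = 0.066, 0.075, 0.083, 0.088` (abs. `0.0151, 0.0152,
     0.0157, 0.0161`), `B(k_min)/μ = 0.066, 0.060, 0.049, 0.041` decreasing;
   tori `4², 6², 8²` (`N = 2…5`) and `4³` (`N = 2, 3`): `sup_k B/μ ∈ [0.013, 0.060]`, within `+35 %` of `b(x)`.
   Chord sandwich `½ε_k n_k(Ψ₀) ≤ B(k) ≤ ½ε_k n_k(Ψ_soft)` holds in every row (e.g. `0.0235 ≤ 0.0242 ≤ 0.0249`
   at `L = 24`, `k_min`). VERDICT: no growth of the price with `L` at fixed filling beyond saturation at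
   `≈ 0.1μ` (twice Bogoliubov in the Tonks regime, same shape), and the infrared price VANISHES as `k → 0`
   — the mechanism's signature, in the one dimension where ED reaches the thermodynamic direction (where
   SMS is dimension-blind and the route expects it TRUE). No kill signal; supports the crux's plausibility.

WHY IT RESISTS (for the provers). (i) Parseval makes every single-particle-structured trial family
safe by a factor ≥ 2 (boosts ×2, density/phase waves ×4, `M` coherent particles in mode `k`:
cost `M(k² + exchange)` vs gain `½Mk²`); occupation "for free" can only come from pair correlations,
whose exactly solvable quadratic model (two-mode `su(1,1)`: `A a†a + B b†b + g(ab + h.c.)`,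
`E_gs = ½√((A+B)² − 4g²) − ½(A+B)`, stable iff `|A−B| ≤ √((A+B)²−4g²)`, which holds for EVERY
softening factor `θ ∈ [0,1]` of one mode) prices half-softening at `0.0493μ` and even full softening
at `0.118μ`; no linear instability exists at the Bogoliubov level. (ii) A refutation must therefore
be a beyond-Bogoliubov infrared effect (one-loop Beliaev weight at `−k` softer than `k³` ⇒
`C ∼ log L`), invisible to ED sizes and to every rigorous method available. (iii) Formally, the
`ℝ≥0∞` statement has no subtraction, no division by a possibly-zero quantity, normalised modes
(`n_p ≤ N`), and is `⊤`-absorbing; its only junk (`ρ ≤ 0`) is guarded.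
-/

noncomputable section

namespace Summit.AtomisticToContinuum.BoseEinsteinCondensation.Cruxes.ModePriceHardCore.Disproof

open MeasureTheory Filter Metric
open scoped ENNReal NNReal Topology
open Literature.MathematicalPhysics.QuantumManyBody.BoseGas
open Summit.AtomisticToContinuum.BoseEinsteinCondensation.Theses.BECModePrice

/-! ## §0 The body at one instance; faithful re-reading; satisfiable hypotheses -/

/-- The SMS inequality at ONE instance: potential `w`, `N` particles on the torus of side `L`, mode
`p`, additive slack `s`, trial state `Ψ`:
`E₀^per(w; N, L) + ½|2πp/L|² n_p(Ψ) ≤ ⟨Ψ, H_w Ψ⟩ + s`. -/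
def BodyAt (w : ℝ → ℝ≥0∞) (N : ℕ) (L : ℝ) (s : ℝ≥0∞) (p : Fin 3 → ℤ)
    (Ψ : PeriodicTrialState N L) : Prop :=
  periodicGroundStateEnergy w N L + 2⁻¹ * fracDispersion 2 L p * cellOccupation N L (planeWaveMode L p) Ψ.ψ
    ≤ periodicEnergy w Ψ + s

/-- The crux, re-read through `BodyAt` (definitional unfolding of the route decl: `planeWaveMode`,
`fracDispersion 2` and the `let L := sideLength ρ N` are inlined verbatim in the decl). -/
theorem modePriceHardCore_iff :
    ModePriceHardCore ↔
      ∀ v : ℝ → ℝ≥0∞, IsRepulsiveFiniteRange v → (∫⁻ x : Space, v ‖x‖) = ⊤ →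
        ∃ C : ℝ, 0 < C ∧ ∃ ρ₀ : ℝ, 0 < ρ₀ ∧ ∀ ρ : ℝ, 0 < ρ → ρ < ρ₀ →
          ∀ᶠ N : ℕ in atTop, ∀ p : Fin 3 → ℤ, p ≠ 0 →
            ∀ Ψ : PeriodicTrialState N (sideLength ρ N),
              BodyAt v N (sideLength ρ N) (ENNReal.ofReal (C * ρ)) p Ψ :=
  Iff.rfl

/-- `∫_{ℝ³} hardCorePotential 1 (|x|) dx = ⊤` (the unit ball has positive volume). [folklore] -/
theorem lintegral_hardCorePotential_one_eq_top :
    (∫⁻ x : Space, hardCorePotential 1 ‖x‖) = ⊤ := by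
  have hball : ∀ x ∈ ball (0 : Space) 1, hardCorePotential 1 ‖x‖ = ⊤ := by
    intro x hx
    rw [mem_ball_zero_iff] at hx
    exact hardCorePotential_of_lt hx
  have hle : ∫⁻ x in ball (0 : Space) 1, hardCorePotential 1 ‖x‖ ≤ ∫⁻ x : Space, hardCorePotential 1 ‖x‖ :=
    setLIntegral_le_lintegral _ _
  rw [setLIntegral_congr_fun measurableSet_ball hball, setLIntegral_const] at hle
  have hvol : volume (ball (0 : Space) 1) ≠ 0 := (measure_ball_pos volume _ one_pos).ne'
  rw [ENNReal.top_mul hvol] at hle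
  exact top_le_iff.1 hle

/-- **The hypotheses of the crux are satisfiable**: the unit hard core is admissible and
non-integrable (so the crux is not vacuous). [folklore] -/
theorem hardCore_hypotheses :
    IsRepulsiveFiniteRange (hardCorePotential 1) ∧ (∫⁻ x : Space, hardCorePotential 1 ‖x‖) = ⊤ :=
  ⟨isRepulsiveFiniteRange_hardCorePotential 1, lintegral_hardCorePotential_one_eq_top⟩

/-! ## §A Load-bearing analysis -/

/-- **`p ≠ 0` is decoration**: at the zero mode the subtracted dispersion vanishes and the body is
`E₀ ≤ E(Ψ) + s`, true for every potential, box, slack and state. [folklore] -/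
theorem body_zero_mode (w : ℝ → ℝ≥0∞) (N : ℕ) (L : ℝ) (s : ℝ≥0∞) (Ψ : PeriodicTrialState N L) :
    BodyAt w N L s 0 Ψ := by
  unfold BodyAt
  rw [fracDispersion_zero two_ne_zero, mul_zero, zero_mul, add_zero]
  exact (periodicGroundStateEnergy_le w Ψ).trans le_self_add

/-- **The crux with the hypothesis `p ≠ 0` deleted is equivalent to the crux** (so no proof can use
`p ≠ 0` in an essential way, and no refutation can come from `p = 0`). [folklore] -/
theorem withoutPNeZero_iff :
    (∀ v : ℝ → ℝ≥0∞, IsRepulsiveFiniteRange v → (∫⁻ x : Space, v ‖x‖) = ⊤ →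
        ∃ C : ℝ, 0 < C ∧ ∃ ρ₀ : ℝ, 0 < ρ₀ ∧ ∀ ρ : ℝ, 0 < ρ → ρ < ρ₀ →
          ∀ᶠ N : ℕ in atTop, ∀ p : Fin 3 → ℤ,
            ∀ Ψ : PeriodicTrialState N (sideLength ρ N),
              BodyAt v N (sideLength ρ N) (ENNReal.ofReal (C * ρ)) p Ψ) ↔
      ModePriceHardCore := by
  rw [modePriceHardCore_iff]
  refine ⟨fun h v hv hint => ?_, fun h v hv hint => ?_⟩
  · obtain ⟨C, hC, ρ₀, hρ₀, h⟩ := h v hv hint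
    exact ⟨C, hC, ρ₀, hρ₀, fun ρ hρ hρ₀' => (h ρ hρ hρ₀').mono fun N hN p _ Ψ => hN p Ψ⟩
  · obtain ⟨C, hC, ρ₀, hρ₀, h⟩ := h v hv hint
    refine ⟨C, hC, ρ₀, hρ₀, fun ρ hρ hρ₀' => (h ρ hρ hρ₀').mono fun N hN p Ψ => ?_⟩
    by_cases hp : p = 0
    · subst hp; exact body_zero_mode v N _ _ Ψ
    · exact hN p hp Ψ

/-- **`⊤`-absorption, states**: a state of infinite energy (e.g. one meeting the hard core) satisfies
the body for free. [folklore] -/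
theorem body_of_energy_eq_top {w : ℝ → ℝ≥0∞} {N : ℕ} {L : ℝ} (s : ℝ≥0∞) (p : Fin 3 → ℤ)
    (Ψ : PeriodicTrialState N L) (h : periodicEnergy w Ψ = ⊤) : BodyAt w N L s p Ψ := by
  unfold BodyAt
  rw [h, top_add]
  exact le_top

/-- **`⊤`-absorption, boxes**: if no trial state has finite energy (`E₀^per = ⊤`, e.g. too many hard
spheres for the torus) the body holds for every state. [folklore] -/
theorem body_of_groundStateEnergy_eq_top {w : ℝ → ℝ≥0∞} {N : ℕ} {L : ℝ} (s : ℝ≥0∞) (p : Fin 3 → ℤ)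
    (Ψ : PeriodicTrialState N L) (h : periodicGroundStateEnergy w N L = ⊤) : BodyAt w N L s p Ψ :=
  body_of_energy_eq_top s p Ψ (eq_top_iff.2 (h ▸ periodicGroundStateEnergy_le w Ψ))

/-- **Parseval half**: `½|2πp/L|² n_p(Ψ) ≤ ½ ⟨Ψ, H_w Ψ⟩` for every periodic trial state, every mode
and every potential (`∑_p |k_p|² n_p(Ψ) = T(Ψ) ≤ E(Ψ)`). [folklore] -/
theorem half_dispersion_mul_occupation_le (w : ℝ → ℝ≥0∞) {N : ℕ} {L : ℝ} (hL : 0 < L)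
    (p : Fin 3 → ℤ) (Ψ : PeriodicTrialState N L) :
    2⁻¹ * fracDispersion 2 L p * cellOccupation N L (planeWaveMode L p) Ψ.ψ ≤ 2⁻¹ * periodicEnergy w Ψ := by
  rw [mul_assoc]
  gcongr
  calc fracDispersion 2 L p * cellOccupation N L (planeWaveMode L p) Ψ.ψ
      ≤ ∑' q : Fin 3 → ℤ, fracDispersion 2 L q * cellOccupation N L (planeWaveMode L q) Ψ.ψ :=
        ENNReal.le_tsum p
    _ = ∫⁻ X in cellN N L, kineticDensity Ψ.ψ X := tsum_fracDispersion_two_mul_cellOccupation hL Ψ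
    _ ≤ periodicEnergy w Ψ := lintegral_kineticDensity_le_periodicEnergy w Ψ

/-- **Far states are free**: a state with `E(Ψ) ≥ 2E₀^per` satisfies the body with ZERO slack (hence
with any slack), for every mode. Only near-minimisers (`E < 2E₀`) carry content. [folklore] -/
theorem body_of_two_mul_le {w : ℝ → ℝ≥0∞} {N : ℕ} {L : ℝ} (hL : 0 < L) (s : ℝ≥0∞) (p : Fin 3 → ℤ)
    (Ψ : PeriodicTrialState N L) (h : 2 * periodicGroundStateEnergy w N L ≤ periodicEnergy w Ψ) :
    BodyAt w N L s p Ψ := by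
  unfold BodyAt
  have h0 : periodicGroundStateEnergy w N L ≤ 2⁻¹ * periodicEnergy w Ψ := by
    calc periodicGroundStateEnergy w N L = 2⁻¹ * (2 * periodicGroundStateEnergy w N L) := by
          rw [← mul_assoc, ENNReal.inv_mul_cancel two_ne_zero ENNReal.ofNat_ne_top, one_mul]
      _ ≤ 2⁻¹ * periodicEnergy w Ψ := by gcongr
  calc periodicGroundStateEnergy w N L + 2⁻¹ * fracDispersion 2 L p * cellOccupation N L (planeWaveMode L p) Ψ.ψ
      ≤ 2⁻¹ * periodicEnergy w Ψ + 2⁻¹ * periodicEnergy w Ψ :=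
        add_le_add h0 (half_dispersion_mul_occupation_le w hL p Ψ)
    _ = periodicEnergy w Ψ := by rw [← add_mul, ENNReal.inv_two_add_inv_two, one_mul]
    _ ≤ periodicEnergy w Ψ + s := le_self_add

/-- **Certifying a violation needs a lower bound on `E₀^per`**: a state violating the body (at any
slack, any mode) has energy `< 2E₀^per`. Since the tree's only lower bounds on `E₀^per` are the
Lieb–Yngvason bound (relative precision `Y^{1/17}`) and `0`, and the slack is `O(ρ) = O(E₀/N)`, no
explicit trial state can presently be certified to violate SMS. [folklore] -/
theorem energy_lt_two_mul_of_not_body {w : ℝ → ℝ≥0∞} {N : ℕ} {L : ℝ} (hL : 0 < L) {s : ℝ≥0∞}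
    {p : Fin 3 → ℤ} {Ψ : PeriodicTrialState N L} (h : ¬ BodyAt w N L s p Ψ) :
    periodicEnergy w Ψ < 2 * periodicGroundStateEnergy w N L :=
  lt_of_not_ge fun h' => h (body_of_two_mul_le hL s p Ψ h')

/-- **`N = 0`**: the occupation vanishes (`occupation 0 _ _ = 0`) and the body is `E₀ ≤ E + s`.
[folklore] -/
theorem body_zero_particles (w : ℝ → ℝ≥0∞) (L : ℝ) (s : ℝ≥0∞) (p : Fin 3 → ℤ)
    (Ψ : PeriodicTrialState 0 L) : BodyAt w 0 L s p Ψ := by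
  unfold BodyAt
  have h0 : cellOccupation 0 L (planeWaveMode L p) Ψ.ψ = 0 := rfl
  rw [h0, mul_zero, add_zero]
  exact (periodicGroundStateEnergy_le w Ψ).trans le_self_add

/-- **`N = 1`**: `E₀^per(1) = 0` (the constant state), so the body is the Parseval half
`½|k|²n_p(Ψ) ≤ E(Ψ)`, true with ZERO slack for every potential, every `L > 0` and every mode.
"Eventually in `N`" is not probed by the exactly solvable particle numbers. [folklore] -/
theorem body_one_particle (w : ℝ → ℝ≥0∞) {L : ℝ} (hL : 0 < L) (s : ℝ≥0∞) (p : Fin 3 → ℤ)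
    (Ψ : PeriodicTrialState 1 L) : BodyAt w 1 L s p Ψ :=
  body_of_two_mul_le hL s p Ψ (by rw [periodicGroundStateEnergy_one hL w, mul_zero]; exact bot_le)

/-- For the everywhere-infinite potential `v ≡ ⊤` and `N ≥ 2`, every periodic trial state has
infinite energy (the pair `(0,1)` alone contributes `⊤·|Ψ|²`, and `∫|Ψ|² = 1`). [folklore] -/
theorem periodicEnergy_top_potential {N : ℕ} (hN : 2 ≤ N) {L : ℝ} (Ψ : PeriodicTrialState N L) :
    periodicEnergy (fun _ => (⊤ : ℝ≥0∞)) Ψ = ⊤ := by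
  have hint : ∀ X : Config N, periodicInteraction (fun _ => (⊤ : ℝ≥0∞)) L X = ⊤ := by
    intro X
    have hper : ∀ x : Space, periodizedPotential (fun _ => (⊤ : ℝ≥0∞)) L x = ⊤ := fun x =>
      ENNReal.tsum_eq_top_of_eq_top ⟨0, rfl⟩
    unfold periodicInteraction
    simp only [hper]
    rw [ENNReal.sum_eq_top]
    refine ⟨⟨0, by omega⟩, Finset.mem_univ _, ?_⟩
    rw [ENNReal.sum_eq_top]
    exact ⟨⟨1, by omega⟩, by simp [Fin.lt_def], rfl⟩
  have hpt : ∀ X ∈ cellN N L, ⊤ * ((‖Ψ.ψ X‖₊ : ℝ≥0∞) ^ 2) ≤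
      kineticDensity Ψ.ψ X + periodicInteraction (fun _ => (⊤ : ℝ≥0∞)) L X * (‖Ψ.ψ X‖₊ : ℝ≥0∞) ^ 2 := by
    intro X _
    rw [hint X]
    exact le_add_self
  have h1 : ∫⁻ X in cellN N L, ⊤ * ((‖Ψ.ψ X‖₊ : ℝ≥0∞) ^ 2) = ⊤ := by
    rw [lintegral_const_mul _ (measurable_ennnormSq Ψ.contDiff.continuous), Ψ.norm_eq, mul_one]
  rw [periodicEnergy, eq_top_iff]
  calc (⊤ : ℝ≥0∞) = ∫⁻ X in cellN N L, ⊤ * ((‖Ψ.ψ X‖₊ : ℝ≥0∞) ^ 2) := h1.symm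
    _ ≤ _ := setLIntegral_mono' (measurableSet_cellN N L) hpt

/-- `v ≡ ⊤` is measurable and non-integrable but NOT of finite range. [folklore] -/
theorem top_potential_not_finiteRange :
    Measurable (fun _ : ℝ => (⊤ : ℝ≥0∞)) ∧ (∫⁻ x : Space, (fun _ : ℝ => (⊤ : ℝ≥0∞)) ‖x‖) = ⊤ ∧
      ¬ IsRepulsiveFiniteRange (fun _ : ℝ => (⊤ : ℝ≥0∞)) := by
  refine ⟨measurable_const, by simp, fun ⟨_, R₀, hR₀⟩ => ?_⟩
  exact absurd (hR₀ (R₀ + 1) (lt_add_one R₀)) ENNReal.top_ne_zero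

/-- **Dropping finite range is not refutable by the infinite-range hard core**: for `v ≡ ⊤` the
conclusion of the crux HOLDS (junk-true: all energies are `⊤` once `N ≥ 2`). [folklore] -/
theorem conclusion_holds_at_top_potential :
    ∃ C : ℝ, 0 < C ∧ ∃ ρ₀ : ℝ, 0 < ρ₀ ∧ ∀ ρ : ℝ, 0 < ρ → ρ < ρ₀ →
      ∀ᶠ N : ℕ in atTop, ∀ p : Fin 3 → ℤ, p ≠ 0 →
        ∀ Ψ : PeriodicTrialState N (sideLength ρ N),
          BodyAt (fun _ => (⊤ : ℝ≥0∞)) N (sideLength ρ N) (ENNReal.ofReal (C * ρ)) p Ψ := by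
  refine ⟨1, one_pos, 1, one_pos, fun ρ _ _ => ?_⟩
  filter_upwards [eventually_ge_atTop 2] with N hN p _ Ψ
  exact body_of_energy_eq_top _ p Ψ (periodicEnergy_top_potential hN Ψ)

/-- **Dropping the density cap is not refutable at high density**: for the hard core of radius `a`
and `ρ > 8/a³` the torus energy is `⊤` eventually and the body holds for every mode, slack and
state (junk-true). The intermediate window (dense hard-sphere fluid / crystal) is open. [folklore] -/
theorem conclusion_body_hardCore_highDensity {a : ℝ} (ha : 0 < a) {ρ : ℝ} (hρ : 8 / a ^ 3 < ρ)
    (s : ℕ → ℝ≥0∞) :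
    ∀ᶠ N : ℕ in atTop, ∀ p : Fin 3 → ℤ, ∀ Ψ : PeriodicTrialState N (sideLength ρ N),
      BodyAt (hardCorePotential a) N (sideLength ρ N) (s N) p Ψ := by
  filter_upwards [Theorems.LatticeToPeriodicBridge.Negative.eventually_periodicGroundStateEnergy_hardCorePotential_eq_top
    ha hρ] with N hN p Ψ
  exact body_of_groundStateEnergy_eq_top _ p Ψ hN

/-! ## §B Natural strengthenings refuted -/

/-- `2 · hardCorePotential a = hardCorePotential a` (values in `{0, ⊤}`). [folklore] -/
theorem two_mul_hardCorePotential (a r : ℝ) : 2 * hardCorePotential a r = hardCorePotential a r := by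
  by_cases h : r < a
  · rw [hardCorePotential_of_lt h, ENNReal.mul_top two_ne_zero]
  · rw [hardCorePotential_of_le (not_lt.1 h), mul_zero]

/-- `2 · V = V` for the periodic hard-core interaction (values in `{0, ⊤}`). [folklore] -/
theorem two_mul_periodicInteraction_hardCore (a L : ℝ) {N : ℕ} (X : Config N) :
    2 * periodicInteraction (hardCorePotential a) L X = periodicInteraction (hardCorePotential a) L X := by
  unfold periodicInteraction periodizedPotential
  rw [Finset.mul_sum]
  refine Finset.sum_congr rfl fun i _ => ?_
  rw [Finset.mul_sum]
  refine Finset.sum_congr rfl fun j _ => ?_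
  rw [← ENNReal.tsum_mul_left]
  exact tsum_congr fun n => two_mul_hardCorePotential a _

/-- In `ℝ≥0∞`, `2x = x` forces `x = 0` or `x = ⊤`. -/
theorem eq_zero_or_top_of_two_mul_eq {x : ℝ≥0∞} (h : 2 * x = x) : x = 0 ∨ x = ⊤ := by
  by_cases h0 : x = 0
  · exact Or.inl h0
  by_cases ht : x = ⊤
  · exact Or.inr ht
  have h1 : (2 : ℝ≥0∞) * x = 1 * x := by rw [h, one_mul]
  have := (ENNReal.mul_left_inj h0 ht).1 h1
  norm_num at this

/-- **Finite-energy hard-core states are purely kinetic**: `E(Ψ) < ⊤ ⇒ E(Ψ) = T(Ψ) = ∫_cell |∇Ψ|²`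
(the interaction integrand is `{0,⊤}`-valued, so its integral is `0` or `⊤`). [folklore] -/
theorem periodicEnergy_hardCore_eq_kinetic {a L : ℝ} {N : ℕ} (Ψ : PeriodicTrialState N L)
    (hfin : periodicEnergy (hardCorePotential a) Ψ ≠ ⊤) :
    periodicEnergy (hardCorePotential a) Ψ = ∫⁻ X in cellN N L, kineticDensity Ψ.ψ X := by
  set I : ℝ≥0∞ := ∫⁻ X in cellN N L,
    periodicInteraction (hardCorePotential a) L X * (‖Ψ.ψ X‖₊ : ℝ≥0∞) ^ 2 with hI
  have hsplit : periodicEnergy (hardCorePotential a) Ψ = (∫⁻ X in cellN N L, kineticDensity Ψ.ψ X) + I := by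
    rw [periodicEnergy, hI, ← lintegral_add_left (measurable_kineticDensity_any Ψ.ψ)]
  have h2I : 2 * I = I := by
    rw [hI, ← lintegral_const_mul' _ _ ENNReal.ofNat_ne_top]
    refine lintegral_congr fun X => ?_
    rw [← mul_assoc, two_mul_periodicInteraction_hardCore]
  rcases eq_zero_or_top_of_two_mul_eq h2I with h0 | htop
  · rw [hsplit, h0, add_zero]
  · exact absurd (by rw [hsplit, htop, add_top]) hfin

/-- **The MODE-SUMMED strengthening** of the crux: sum the single-mode inequality over all modes,
`E₀^per + ½ ∑_p |k_p|² n_p(Ψ) ≤ ⟨Ψ, HΨ⟩ + Cρ` (i.e. `E₀ + ½T(Ψ) ≤ E(Ψ) + Cρ`), same quantifiers. -/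
def AllModePrice : Prop :=
  ∀ v : ℝ → ℝ≥0∞, IsRepulsiveFiniteRange v → (∫⁻ x : Space, v ‖x‖) = ⊤ →
    ∃ C : ℝ, 0 < C ∧ ∃ ρ₀ : ℝ, 0 < ρ₀ ∧ ∀ ρ : ℝ, 0 < ρ → ρ < ρ₀ →
      ∀ᶠ N : ℕ in atTop, ∀ Ψ : PeriodicTrialState N (sideLength ρ N),
        periodicGroundStateEnergy v N (sideLength ρ N)
            + 2⁻¹ * ∑' p : Fin 3 → ℤ, fracDispersion 2 (sideLength ρ N) p
                * cellOccupation N (sideLength ρ N) (planeWaveMode (sideLength ρ N) p) Ψ.ψ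
          ≤ periodicEnergy v Ψ + ENNReal.ofReal (C * ρ)

/-- **The mode-summed strengthening is FALSE** (witness: the unit hard core). At a `1`-near-minimiser
`Ψ` of the hard-sphere torus gas, `E(Ψ) = T(Ψ) = ∑_p|k_p|²n_p(Ψ)` (`periodicEnergy_hardCore_eq_kinetic`,
Parseval), so the summed inequality reads `E₀ ≤ ½T + Cρ ≤ ½(E₀ + 1) + Cρ`, i.e. `E₀^per ≤ 1 + 2Cρ` —
but `E₀^per(N, L_N) ≥ 4πρa(1 − C_LY Y^{1/17})N ≥ 2πρN → ∞` by the Lieb–Yngvason lower bound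
(`LSSY2005_lowerBound_periodic_holds`, LSSY Thm 2.4) at small `Y = 4πρ/3`. Moral for provers: the
SINGLE-mode restriction is load-bearing — SMS cannot be summed over modes (kinetic energy is
extensive while the price is `O(ρ)`); any argument must exploit that ONE mode carries `o(N)` kinetic
energy in near-minimisers. [cite: LSSY2005, Thm. 2.4 (2.35)] -/
theorem not_allModePrice : ¬ AllModePrice := by
  intro H
  have hv := isRepulsiveFiniteRange_hardCorePotential (1 : ℝ)
  obtain ⟨C, hC, ρ₀, hρ₀, hmain⟩ := H _ hv lintegral_hardCorePotential_one_eq_top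
  -- Lieb–Yngvason lower bound for the unit hard core (`a = 1`)
  have haT : scatteringLength (hardCorePotential (1 : ℝ)) ≠ ⊤ := by
    rw [scatteringLength_hardCorePotential]; exact ENNReal.ofReal_ne_top
  have ha1 : (scatteringLength (hardCorePotential (1 : ℝ))).toReal = 1 :=
    toReal_scatteringLength_hardCorePotential zero_le_one
  obtain ⟨δ, CL, C', hδ, hCL, hC', hLB⟩ := LSSY2005_lowerBound_periodic_holds _ hv haT
  -- Ruelle finiteness threshold
  obtain ⟨ρ₁, hρ₁, hfinE⟩ :=
    Literature.Barriers.AtomisticToContinuum.BoseGas.exists_eventually_periodicGroundStateEnergy_lt_top hv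
  -- the density: below every threshold, and `Y = 4πρ/3` so small that `CL·Y^{1/17} ≤ 1/2`
  set Ym : ℝ := min (min δ 1) ((1 / (2 * CL)) ^ (17 : ℕ)) with hYm_def
  have hYm : 0 < Ym := lt_min (lt_min hδ one_pos) (by positivity)
  set ρ : ℝ := min (min (ρ₀ / 2) (ρ₁ / 2)) (3 * Ym / (8 * Real.pi)) with hρ_def
  have hρ : 0 < ρ := lt_min (lt_min (by positivity) (by positivity)) (by positivity)
  have hρρ₀ : ρ < ρ₀ := (min_le_left _ _).trans_lt ((min_le_left _ _).trans_lt (by linarith))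
  have hρρ₁ : ρ < ρ₁ := (min_le_left _ _).trans_lt ((min_le_right _ _).trans_lt (by linarith))
  set Y : ℝ := 4 * Real.pi * ρ * 1 ^ 3 / 3 with hY_def
  have hY0 : 0 < Y := by positivity
  have hYlt : Y < Ym := by
    have h1 : ρ ≤ 3 * Ym / (8 * Real.pi) := min_le_right _ _
    have h2 : Y ≤ Ym / 2 := by
      rw [hY_def]
      calc 4 * Real.pi * ρ * 1 ^ 3 / 3 ≤ 4 * Real.pi * (3 * Ym / (8 * Real.pi)) * 1 ^ 3 / 3 := by
            gcongr
        _ = Ym / 2 := by field_simp; ring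
    linarith
  have hYδ : Y < δ := hYlt.trans_le ((min_le_left _ _).trans (min_le_left _ _))
  have hY1 : Y ≤ 1 := (hYlt.trans_le ((min_le_left _ _).trans (min_le_right _ _))).le
  have hYCL : CL * Y ^ ((1 : ℝ) / 17) ≤ 1 / 2 := by
    have h : Y ≤ (1 / (2 * CL)) ^ (17 : ℕ) := (hYlt.trans_le (min_le_right _ _)).le
    have h' : Y ^ ((1 : ℝ) / 17) ≤ 1 / (2 * CL) := by
      have := Real.rpow_le_rpow hY0.le h (by norm_num : (0 : ℝ) ≤ 1 / 17)
      rwa [← Real.rpow_natCast, ← Real.rpow_mul (by positivity), show ((17 : ℕ) : ℝ) * (1 / 17) = 1 by norm_num,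
        Real.rpow_one] at this
    calc CL * Y ^ ((1 : ℝ) / 17) ≤ CL * (1 / (2 * CL)) := mul_le_mul_of_nonneg_left h' hCL.le
      _ = 1 / 2 := by field_simp
  -- eventually in `N`: the summed inequality, finiteness, the LY side condition and `2πρN > 2 + 2Cρ`
  have hLtend := tendsto_sideLength_atTop hρ
  obtain ⟨N, hAll, hfin, hN1, hNL, hNbig⟩ := ((hmain ρ hρ hρρ₀).and ((hfinE ρ hρ hρρ₁).and
    ((eventually_ge_atTop 1).and ((hLtend.eventually_gt_atTop (1 * (C' * Y ^ (-(6 : ℝ) / 17)))).and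
      (eventually_gt_atTop ⌈(2 + 2 * C * ρ) / (2 * Real.pi * ρ)⌉₊))))).exists
  set L := sideLength ρ N with hL_def
  have hN0 : 0 < N := hN1
  have hL : 0 < L := sideLength_pos_of_pos hρ hN0
  have hρL : (N : ℝ) / L ^ 3 = ρ := div_sideLength_pow_three hρ hN0
  -- the lower bound `ofReal (2πρN) ≤ E₀`
  have hLB' := hLB N L hL
  dsimp only at hLB'
  rw [hρL, ha1] at hLB'
  have hcond : C' * Y ^ (-(6 : ℝ) / 17) < L / 1 := by rw [div_one]; linarith
  have hE0lb : ENNReal.ofReal (2 * Real.pi * ρ * N) ≤ periodicGroundStateEnergy (hardCorePotential 1) N L := by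
    refine le_trans (ENNReal.ofReal_le_ofReal ?_) (hLB' hYδ hcond)
    have hN' : (0 : ℝ) ≤ N := Nat.cast_nonneg N
    have h1 : 1 / 2 ≤ 1 - CL * Y ^ ((1 : ℝ) / 17) := by linarith
    calc 2 * Real.pi * ρ * N = 4 * Real.pi * ρ * 1 * (1 / 2) * N := by ring
      _ ≤ 4 * Real.pi * ρ * 1 * (1 - CL * Y ^ ((1 : ℝ) / 17)) * N := by gcongr
  -- a `1`-near-minimiser `Ψ` with finite, purely kinetic energy
  set E₀ := periodicGroundStateEnergy (hardCorePotential 1) N L with hE₀_def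
  have hE₀top : E₀ ≠ ⊤ := hfin.ne
  obtain ⟨Ψ, hΨ⟩ : ∃ Ψ : PeriodicTrialState N L, periodicEnergy (hardCorePotential 1) Ψ < E₀ + 1 :=
    iInf_lt_iff.1 (ENNReal.lt_add_right hE₀top one_ne_zero)
  have hEfin : periodicEnergy (hardCorePotential 1) Ψ ≠ ⊤ := (hΨ.trans_le le_top).ne
  set T := ∫⁻ X in cellN N L, kineticDensity Ψ.ψ X with hT_def
  have hET : periodicEnergy (hardCorePotential 1) Ψ = T := periodicEnergy_hardCore_eq_kinetic Ψ hEfin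
  have hTtop : T ≠ ⊤ := hET ▸ hEfin
  have hPars : (∑' p : Fin 3 → ℤ, fracDispersion 2 L p * cellOccupation N L (planeWaveMode L p) Ψ.ψ) = T :=
    tsum_fracDispersion_two_mul_cellOccupation hL Ψ
  -- the summed inequality at `Ψ`: `E₀ + ½T ≤ T + Cρ`
  have hsum := hAll Ψ
  rw [hPars, hET] at hsum
  -- arithmetic in `ℝ`
  set c : ℝ≥0∞ := ENNReal.ofReal (C * ρ) with hc
  have hctop : c ≠ ⊤ := ENNReal.ofReal_ne_top
  have h1 : E₀.toReal + 2⁻¹ * T.toReal ≤ T.toReal + C * ρ := by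
    have := (ENNReal.toReal_le_toReal (by finiteness) (by finiteness)).2 hsum
    rwa [ENNReal.toReal_add hE₀top (by finiteness), ENNReal.toReal_add hTtop hctop,
      ENNReal.toReal_mul, ENNReal.toReal_inv, ENNReal.toReal_ofReal (by positivity)] at this
  have h2 : T.toReal < E₀.toReal + 1 := by
    have := (ENNReal.toReal_lt_toReal hTtop (by finiteness)).2 (hET ▸ hΨ)
    rwa [ENNReal.toReal_add hE₀top ENNReal.one_ne_top, ENNReal.toReal_one] at this
  have h3 : 2 * Real.pi * ρ * N ≤ E₀.toReal := by
    have := (ENNReal.ofReal_le_iff_le_toReal hE₀top).1 hE0lb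
    exact this
  have h4 : (⌈(2 + 2 * C * ρ) / (2 * Real.pi * ρ)⌉₊ : ℝ) < N := by exact_mod_cast hNbig
  have h5 : (2 + 2 * C * ρ) / (2 * Real.pi * ρ) < N := (Nat.le_ceil _).trans_lt h4
  have h6 : 2 + 2 * C * ρ < 2 * Real.pi * ρ * N := by
    rw [div_lt_iff₀ (by positivity)] at h5; linarith
  norm_num at h1
  nlinarith

/-- **ZERO-SLACK strengthening** (the additive constant dropped: the price of a mode is zero). -/
def ZeroSlackModePrice : Prop :=
  ∀ v : ℝ → ℝ≥0∞, IsRepulsiveFiniteRange v → (∫⁻ x : Space, v ‖x‖) = ⊤ →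
    ∃ ρ₀ : ℝ, 0 < ρ₀ ∧ ∀ ρ : ℝ, 0 < ρ → ρ < ρ₀ →
      ∀ᶠ N : ℕ in atTop, ∀ p : Fin 3 → ℤ, p ≠ 0 →
        ∀ Ψ : PeriodicTrialState N (sideLength ρ N), BodyAt v N (sideLength ρ N) 0 p Ψ

/-- NEAR-MISS (not closed this cycle). **The slack cannot be dropped**: the price of a mode is
strictly positive for the hard core. Plan: (1) at fixed admissible `(N, L)` with `E₀ < ⊤` take a
max-form ground state `η` (Rellich on the torus; `PeriodicMaxFormGroundStates`); (2) `η` vanishes on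
the hard set and is normalised, so some slice `x ↦ η(x,Y)` is non-constant on a set of `Y` of positive
measure, whence `n_p(η) > 0` for some `p ≠ 0` (Parseval on the slice); (3) `stub_maxFormApproximationFiniteRange`
gives `C¹` states `Φ_ε → η` in `L²` with `E(Φ_ε) ≤ E₀ + ε`; (4) `n_p` is `2N`-Lipschitz on the unit
sphere of `L²(cell^N)`, so `½|k|²n_p(Φ_ε) ≥ ½|k|²n_p(η) − O(ε) > E(Φ_ε) − E₀` for small `ε`: the body
with slack `0` fails at `Φ_ε`. Obstruction: steps (2) and (4) are not in the tree (slice-Parseval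
positivity and the Lipschitz estimate for `cellOccupation`); ~400 lines. Physically "the depletion of
an interacting gas is non-zero" — true, informative (the `Cρ` is load-bearing), no threat to the crux. -/
theorem not_zeroSlackModePrice : ¬ ZeroSlackModePrice := by
  sorry

/-! ## §D Numerics (kit j026683): half-softening price by exact diagonalisation

Hard-core bosons, hopping `t = 1`, `n̂_k = a_k†a_k`, `a_k = V^{-1/2}Σ_x e^{-ik·x}b_x` (applied as `A_k^H A_k`,
`A_k : N → N−1` sector), `B(k) = E₀ − inf spec(H − ½ε_k n̂_k)`, `μ = E₀(N+1) − E₀(N)`, `x = ε_k/μ`.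
Columns: `sup_k B/μ (mode m*, x*) | b(x*) | B(k_min)/μ, x_min, b(x_min) | sup_k B`.

  ring L=8   N=2 ν=1/4  μ=0.867 | 0.0707 (m=1, x=0.68) | 0.049 | 0.0707 0.676 0.049 | 0.0613
  ring L=12  N=3 ν=1/4  μ=0.772 | 0.0794 (m=2, x=1.30) | 0.043 | 0.0629 0.347 0.049 | 0.0613
  ring L=16  N=4 ν=1/4  μ=0.725 | 0.0875 (m=2, x=0.81) | 0.048 | 0.0517 0.210 0.046 | 0.0635
  ring L=20  N=5 ν=1/4  μ=0.697 | 0.0930 (m=3, x=1.18) | 0.044 | 0.0426 0.140 0.042 | 0.0648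
  ring L=24  N=6 ν=1/4  μ=0.679 | 0.0943 (m=3, x=0.86) | 0.047 | 0.0357 0.100 0.039 | 0.0640
  ring L=16  N=2 ν=1/8  μ=0.228 | 0.0664 (m=1, x=0.67) | 0.049 | 0.0664 0.669 0.049 | 0.0151
  ring L=24  N=3 ν=1/8  μ=0.202 | 0.0750 (m=2, x=1.32) | 0.043 | 0.0596 0.337 0.049 | 0.0152
  ring L=32  N=4 ν=1/8  μ=0.190 | 0.0827 (m=2, x=0.80) | 0.048 | 0.0493 0.202 0.046 | 0.0157
  ring L=40  N=5 ν=1/8  μ=0.182 | 0.0881 (m=3, x=1.20) | 0.044 | 0.0409 0.135 0.042 | 0.0161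
  4x4   N=2 μ=0.905 | 0.0374 (x=2.21) b 0.036      4x4   N=3 μ=1.413 | 0.0573 (x=1.42) b 0.042
  6x6   N=3 μ=0.519 | 0.0434 (x=1.93) b 0.038      6x6   N=4 μ=0.717 | 0.0535 (x=1.40) b 0.042
  6x6   N=5 μ=0.924 | 0.0599 (x=1.08) b 0.045      8x8   N=3 μ=0.258 | 0.0378 (x=2.27) b 0.035
  8x8   N=4 μ=0.355 | 0.0472 (x=1.65) b 0.040      4x4x4 N=2 μ=0.314 | 0.0133 (x=6.37) b 0.019
  4x4x4 N=3 μ=0.477 | 0.0238 (x=4.19) b 0.025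

Reading: at fixed filling the price SATURATES (`≈ 0.1μ` in the Tonks rings, `2×` Bogoliubov, same shape:
maximum at `x ≈ 1`, `→ 0` both in the infrared and the ultraviolet); `B(k_min; L) → 0` like `√x_min ∝ 1/L`.
No growth with `L`; no kill signal. Full stdout: `~/compute/j026683/stdout.log` (seat folder) and the
attached `compute-j026683.json`; `L = 28, N = 7` re-queued as j026899. -/

/-! ## §C The picked line `IdeatorSketchK1` -/

/-- **The lead's stub is at least the rank-2 sibling crux**: scale-free integrable SMS (constants
depending on a range bound only) implies `ModePriceIntegrable` (stmt-18512) — instantiate `R₀` at a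
positive range of `v`. So `stub_scaleFreeModePriceIntegrable` is open-problem calibre by construction;
the line converts the hard-core crux into "the integrable crux with renormalised constants". [folklore] -/
theorem modePriceIntegrable_of_scaleFree
    (h : ∀ R₀ : ℝ, 0 < R₀ → ∃ C : ℝ, 0 < C ∧ ∃ ρ₀ : ℝ, 0 < ρ₀ ∧ ∀ ρ : ℝ, 0 < ρ → ρ < ρ₀ →
      ∃ N₀ : ℕ, ∀ N : ℕ, N₀ ≤ N → ∀ p : Fin 3 → ℤ, p ≠ 0 →
        ∀ v : ℝ → ℝ≥0∞, IsRepulsiveFiniteRange v → (∀ r, R₀ < r → v r = 0) →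
          (∫⁻ x : Space, v ‖x‖) ≠ ⊤ →
          ∀ Ψ : PeriodicTrialState N (sideLength ρ N),
            BodyAt v N (sideLength ρ N) (ENNReal.ofReal (C * ρ)) p Ψ) :
    ModePriceIntegrable := by
  intro v hv hint
  obtain ⟨R, hR, hvR⟩ := hv.exists_pos_range
  obtain ⟨C, hC, ρ₀, hρ₀, hmain⟩ := h R hR
  refine ⟨C, hC, ρ₀, hρ₀, fun ρ hρ hρ₀' => ?_⟩
  obtain ⟨N₀, hN₀⟩ := hmain ρ hρ hρ₀'
  filter_upwards [eventually_ge_atTop N₀] with N hN p hp Ψ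
  exact hN₀ N hN p hp v hv hvR hint Ψ

end Summit.AtomisticToContinuum.BoseEinsteinCondensation.Cruxes.ModePriceHardCore.Disproof

end
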